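import Literature.Computability.Complexity.FKPointLocationRecordsFP
import Literature.Computability.Complexity.FKPointLocationNPChecks
import HarnessLib

/-!
# Fournier–Koiran point location, XV: the `NP` verifiers of the location procedure are polynomial-time

Topic `Literature/Computability/Complexity`, grouping namespace `FKPointLocation`. Typed
polynomial-time programs (`CodeFP`) for the Boolean verifiers of `FKPointLocationNPChecks.lean`
(the four `NP` conditions of Fournier–Koiran's location procedure, ICALP 2000 = LIP RR-1999-21,
§2.1: a valid triple for the next chain slot, a prefix of its code, instability of a scale, a
prefix of the code of an apex): `uLiveIFP`, `ufreeMassFP`, `uMeetsIFP`, `uInEFP`, `uNearFP`,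
`uTripleCoreFP`, `uExCheckFP`, `uPfCheckFP`, `uStCheckFP`, `uApCheckFP`, and the task dispatch
`ucheck` / **`ucheckFP`** on the input `((P, B), d, τ, cert)` (parameters with the coefficient bound
`B`, state, task, certificate). Scales read off a task (and the stable scale) are clamped to `amax`, which is the identity on the
schedule (`argsLe_of_mem_uagenda`) and keeps every exponent unary.

## References

* H. Fournier, P. Koiran, *Lower bounds are not easier over the reals: inside PH*, ICALP 2000,
  LNCS 1853 = LIP RR-1999-21, §2.1 (the `NP` conditions), §2.2 (their polynomial size). [FournierKoiran2000]
* S. Arora, B. Barak, *Computational Complexity: A Modern Approach*, CUP 2009, §1.3, Def. 2.1. [AroraBarak2009]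
-/

namespace Literature.Computability.Complexity

namespace FKPointLocation

open _root_.Computability CodeFP Polynomial

/-! ### The integer tests -/

section Tests

/-- Liveness `uLiveI B prev a` from `(B, prev, a)`. [cite: FournierKoiran2000, §2.1] -/
theorem uLiveIFP : CodeFP (pairE natE (pairE (rawE vecE) vecE)) bitE (fun p => uLiveI p.1 p.2.1 p.2.2) := by
  have hB : CodeFP (pairE natE (pairE (rawE vecE) vecE)) natE (fun p => p.1) := fst _ _
  have hprev : CodeFP (pairE natE (pairE (rawE vecE) vecE)) (rawE vecE) (fun p => p.2.1) := (snd _ _).fst'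
  have ha : CodeFP (pairE natE (pairE (rawE vecE) vecE)) vecE (fun p => p.2.2) := (snd _ _).snd'
  have h1 : CodeFP (pairE natE (pairE (rawE vecE) vecE)) bitE (fun p => p.2.2.all fun x => decide (x.natAbs ≤ p.1)) :=
    ((all (natLe.comp ((intNatAbs.comp (snd _ _)).pair (fst _ _)))).comp (hB.pair ha) :)
  have h2 : CodeFP (pairE natE (pairE (rawE vecE) vecE)) bitE (fun p => p.2.1.all fun σ => decide (udot p.2.2 σ = 0)) :=
    ((all (intEq.comp ((udotFP.comp ((fst _ _).pair (snd _ _))).pair (const _ (0 : ℤ))))).comp (ha.pair hprev) :)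
  exact (h1.and h2).congr fun p => by simp only [uLiveI]

/-- The free mass `ufreeMass χ a` from `(χ, a)`. [folklore] -/
theorem ufreeMassFP : CodeFP (pairE vecE vecE) natE (fun p => ufreeMass p.1 p.2) := by
  have hg : CodeFP (pairE unitE (pairE intE intE)) natE (fun t => if t.2.1 = 0 then t.2.2.natAbs else 0) :=
    ((intEq.comp ((snd _ _).fst'.pair (const _ (0 : ℤ)))).ite (intNatAbs.comp (snd _ _).snd') (const _ 0)).congr fun t => by
      simp only [decide_eq_true_eq]
  have hz := (zipWith (σ := Unit) (eσ := unitE) (g := fun t : Unit × ℤ × ℤ => if t.2.1 = 0 then t.2.2.natAbs else 0) hg :)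
  exact ((natSum.comp (hz.comp ((const _ ()).pair (CodeFP.id _)))) :).congr fun p => by simp only [ufreeMass, id]

/-- The meeting test `uMeetsI κ sc χ m a` from `(1^{κ sc}, χ, m, a)` (the exponent in unary). [cite: FournierKoiran2000, §2.1] -/
theorem uMeetsIFP' : CodeFP (pairE unE (pairE vecE (pairE vecE vecE))) bitE
    (fun p => decide ((udot p.2.2.2 p.2.2.1).natAbs ≤ 2 ^ p.1 * ufreeMass p.2.1 p.2.2.2)) := by
  have he : CodeFP (pairE unE (pairE vecE (pairE vecE vecE))) unE (fun p => p.1) := fst _ _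
  have hχ : CodeFP (pairE unE (pairE vecE (pairE vecE vecE))) vecE (fun p => p.2.1) := (snd _ _).fst'
  have hm : CodeFP (pairE unE (pairE vecE (pairE vecE vecE))) vecE (fun p => p.2.2.1) := (snd _ _).snd'.fst'
  have ha : CodeFP (pairE unE (pairE vecE (pairE vecE vecE))) vecE (fun p => p.2.2.2) := (snd _ _).snd'.snd'
  exact (natLe.comp ((intNatAbs.comp (udotFP.comp (ha.pair hm))).pair (natMul.comp ((natPow.comp ((const _ 2).pair he)).pair
    (ufreeMassFP.comp (hχ.pair ha))))) :)

/-- Membership of `N/dd` in `E ch` for the chart `χ`: `uInE χ ch N dd` from `(χ, ch, N, dd)`. [cite: FournierKoiran2000, §2.1] -/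
theorem uInEFP : CodeFP (pairE vecE (pairE (rawE vecE) (pairE vecE natE))) bitE (fun p => uInE p.1 p.2.1 p.2.2.1 p.2.2.2) := by
  have hχ : CodeFP (pairE vecE (pairE (rawE vecE) (pairE vecE natE))) vecE (fun p => p.1) := fst _ _
  have hch : CodeFP (pairE vecE (pairE (rawE vecE) (pairE vecE natE))) (rawE vecE) (fun p => p.2.1) := (snd _ _).fst'
  have hN : CodeFP (pairE vecE (pairE (rawE vecE) (pairE vecE natE))) vecE (fun p => p.2.2.1) := (snd _ _).snd'.fst'
  have hdd : CodeFP (pairE vecE (pairE (rawE vecE) (pairE vecE natE))) natE (fun p => p.2.2.2) := (snd _ _).snd'.snd'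
  have hg : CodeFP (pairE natE (pairE intE intE)) bitE (fun t => decide (t.2.1 = 0 ∨ t.2.2 = t.2.1 * (t.1 : ℤ))) :=
    ((intEq.comp ((snd _ _).fst'.pair (const _ (0 : ℤ)))).or (intEq.comp ((snd _ _).snd'.pair
      (intMul.comp ((snd _ _).fst'.pair (intOfNat.comp (fst _ _))))))).congr fun t => by simp only [Bool.decide_or]
  have hz := (zipWith (σ := ℕ) (eσ := natE) (g := fun t : ℕ × ℤ × ℤ => decide (t.2.1 = 0 ∨ t.2.2 = t.2.1 * (t.1 : ℤ))) hg :)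
  have h2 : CodeFP (pairE vecE (pairE (rawE vecE) (pairE vecE natE))) bitE
      (fun p => (List.zipWith (fun c x => decide (c = 0 ∨ x = c * (p.2.2.2 : ℤ))) p.1 p.2.2.1).all _root_.id) :=
    ((all (σ := Unit) (eσ := unitE) ((snd _ _) : CodeFP (pairE unitE bitE) bitE (fun t => t.2))).comp
      ((const _ ()).pair (hz.comp (hdd.pair (hχ.pair hN))))).congr fun p => by simp only; rfl
  have h3 : CodeFP (pairE vecE (pairE (rawE vecE) (pairE vecE natE))) bitE (fun p => p.2.1.all fun a => decide (udot a p.2.2.1 = 0)) :=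
    ((all (intEq.comp ((udotFP.comp ((snd _ _).pair (fst _ _))).pair (const _ (0 : ℤ))))).comp (hN.pair hch) :)
  have h1 : CodeFP (pairE vecE (pairE (rawE vecE) (pairE vecE natE))) bitE (fun p => decide (0 < p.2.2.2)) :=
    (natLt.comp ((const _ 0).pair hdd) :)
  exact ((h1.and h2).and h3).congr fun p => by simp only [uInE]

/-- The nearness test `uNear L e χ m N dd` from `(1ᴸ, 1ᵉ, χ, m, N, dd)`. [cite: FournierKoiran2000, §2.1] -/
theorem uNearFP : CodeFP (pairE unE (pairE unE (pairE vecE (pairE vecE (pairE vecE natE))))) bitE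
    (fun p => uNear p.1 p.2.1 p.2.2.1 p.2.2.2.1 p.2.2.2.2.1 p.2.2.2.2.2) := by
  -- context `(2^{L+1}, dd, dd 2^e)`, items `c` and `(mᵢ, Nᵢ)`
  have hg : CodeFP (pairE (pairE intE (pairE intE natE)) (pairE intE (pairE intE intE))) bitE
      (fun t => decide (t.2.1 = 0 → 4 * (t.2.2.2 * t.1.1 - t.2.2.1 * t.1.2.1).natAbs ≤ t.1.2.2)) := by
    have hc : CodeFP (pairE (pairE intE (pairE intE natE)) (pairE intE (pairE intE intE))) bitE (fun t => decide (t.2.1 = 0)) :=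
      (intEq.comp ((snd _ _).fst'.pair (const _ (0 : ℤ))) :)
    have hv : CodeFP (pairE (pairE intE (pairE intE natE)) (pairE intE (pairE intE intE))) natE
        (fun t => 4 * (t.2.2.2 * t.1.1 - t.2.2.1 * t.1.2.1).natAbs) :=
      (natMul.comp ((const _ 4).pair (intNatAbs.comp (intSub.comp ((intMul.comp ((snd _ _).snd'.snd'.pair (fst _ _).fst')).pair
        (intMul.comp ((snd _ _).snd'.fst'.pair (fst _ _).snd'.fst')))))) :)
    have hle : CodeFP (pairE (pairE intE (pairE intE natE)) (pairE intE (pairE intE intE))) bitE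
        (fun t => decide (4 * (t.2.2.2 * t.1.1 - t.2.2.1 * t.1.2.1).natAbs ≤ t.1.2.2)) := (natLe.comp (hv.pair (fst _ _).snd'.snd') :)
    exact (hc.not.or hle).congr fun t => by
      by_cases h1 : t.2.1 = 0 <;> by_cases h2 : 4 * (t.2.2.2 * t.1.1 - t.2.2.1 * t.1.2.1).natAbs ≤ t.1.2.2 <;> simp [h1, h2]
  have hz := (zipWith (g := fun t : (ℤ × ℤ × ℕ) × ℤ × ℤ × ℤ => decide (t.2.1 = 0 → 4 * (t.2.2.2 * t.1.1 - t.2.2.1 * t.1.2.1).natAbs ≤ t.1.2.2)) hg :)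
  have hzip := (zipWith (σ := Unit) (eσ := unitE) (eα := intE) (eβ := intE) (g := fun t : Unit × ℤ × ℤ => (t.2.1, t.2.2)) ((snd _ _).fst'.pair (snd _ _).snd') :)
  -- the projections of the input
  have hL : CodeFP (pairE unE (pairE unE (pairE vecE (pairE vecE (pairE vecE natE))))) unE (fun p => p.1) := fst _ _
  have he : CodeFP (pairE unE (pairE unE (pairE vecE (pairE vecE (pairE vecE natE))))) unE (fun p => p.2.1) := (snd _ _).fst'
  have hχ : CodeFP (pairE unE (pairE unE (pairE vecE (pairE vecE (pairE vecE natE))))) vecE (fun p => p.2.2.1) := (snd _ _).snd'.fst'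
  have hm : CodeFP (pairE unE (pairE unE (pairE vecE (pairE vecE (pairE vecE natE))))) vecE (fun p => p.2.2.2.1) := (snd _ _).snd'.snd'.fst'
  have hN : CodeFP (pairE unE (pairE unE (pairE vecE (pairE vecE (pairE vecE natE))))) vecE (fun p => p.2.2.2.2.1) := (snd _ _).snd'.snd'.snd'.fst'
  have hdd : CodeFP (pairE unE (pairE unE (pairE vecE (pairE vecE (pairE vecE natE))))) natE (fun p => p.2.2.2.2.2) := (snd _ _).snd'.snd'.snd'.snd'
  have hctx : CodeFP (pairE unE (pairE unE (pairE vecE (pairE vecE (pairE vecE natE))))) (pairE intE (pairE intE natE))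
      (fun p => ((2 : ℤ) ^ (p.1 + 1), (p.2.2.2.2.2 : ℤ), p.2.2.2.2.2 * 2 ^ p.2.1)) :=
    ((intPow.comp ((const _ (2 : ℤ)).pair (unSucc.comp hL))).pair ((intOfNat.comp hdd).pair
      (natMul.comp (hdd.pair (natPow.comp ((const _ 2).pair he))))) :)
  have hpairs : CodeFP (pairE unE (pairE unE (pairE vecE (pairE vecE (pairE vecE natE))))) (rawE (pairE intE intE))
      (fun p => List.zipWith (fun a b => (a, b)) p.2.2.2.1 p.2.2.2.2.1) :=
    (hzip.comp ((const _ ()).pair (hm.pair hN)) :)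
  refine (((all (σ := Unit) (eσ := unitE) ((snd _ _) : CodeFP (pairE unitE bitE) bitE (fun t => t.2))).comp
    ((const _ ()).pair (hz.comp (hctx.pair (hχ.pair hpairs))))).congr fun p => ?_)
  simp only [uNear]
  rfl

end Tests

/-! ### The verifiers -/

section Verifiers

/-- The input of the verifiers: parameters with the coefficient bound `B`, state, task, certificate. [folklore] -/
abbrev CIn : Type := (UParams × ℕ) × UData × UTask × List Bool

/-- Its code. [folklore] -/
abbrev cinE : CIn → List Bool := pairE (pairE paramsE natE) (pairE dataE (pairE taskE strE))

/-- Projection (parameters). [folklore] -/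
theorem cin_P : CodeFP cinE paramsE (fun q : CIn => q.1.1) := (fst _ _).fst'
/-- Projection (`B`). [folklore] -/
theorem cin_B : CodeFP cinE natE (fun q : CIn => q.1.2) := (fst _ _).snd'
/-- Projection (state). [folklore] -/
theorem cin_d : CodeFP cinE dataE (fun q : CIn => q.2.1) := (snd _ _).fst'
/-- Projection (task). [folklore] -/
theorem cin_τ : CodeFP cinE taskE (fun q : CIn => q.2.2.1) := (snd _ _).snd'.fst'
/-- Projection (certificate). [folklore] -/
theorem cin_cert : CodeFP cinE strE (fun q : CIn => q.2.2.2) := (snd _ _).snd'.snd'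
/-- Projection (scratch). [folklore] -/
theorem cin_cur : CodeFP cinE scrE (fun q : CIn => q.2.1.cur) := (data_cur.comp cin_d :)
/-- Projection (chart). [folklore] -/
theorem cin_chart : CodeFP cinE vecE (fun q : CIn => q.2.1.chart) := (data_chart.comp cin_d :)
/-- Projection (task argument `j`). [folklore] -/
theorem cin_arg (j : ℕ) : CodeFP cinE natE (fun q : CIn => q.2.2.1.args.getD j 0) := ((task_arg j).comp cin_τ :)
/-- Projection (`D`, unary). [folklore] -/
theorem cin_D : CodeFP cinE unE (fun q : CIn => q.1.1.D) := (params_D.comp cin_P :)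
/-- Projection (`κ`, unary). [folklore] -/
theorem cin_κ : CodeFP cinE unE (fun q : CIn => q.1.1.κ) := (params_κ.comp cin_P :)
/-- Projection (`L`, unary). [folklore] -/
theorem cin_L : CodeFP cinE unE (fun q : CIn => q.1.1.L) := (params_L.comp cin_P :)
/-- Projection (`W`, unary). [folklore] -/
theorem cin_W : CodeFP cinE unE (fun q : CIn => q.1.1.W) := (params_W.comp cin_P :)
/-- Projection (`bB`, unary). [folklore] -/
theorem cin_bB : CodeFP cinE unE (fun q : CIn => q.1.1.bB) := (params_bB.comp cin_P :)
/-- Projection (`Wf`, unary). [folklore] -/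
theorem cin_Wf : CodeFP cinE unE (fun q : CIn => q.1.1.Wf) := (params_Wf.comp cin_P :)
/-- Projection (`Wa`, unary). [folklore] -/
theorem cin_Wa : CodeFP cinE unE (fun q : CIn => q.1.1.Wa) := (params_Wa.comp cin_P :)
/-- The earlier apex numerators. [folklore] -/
theorem cin_prev : CodeFP cinE (rawE vecE) (fun q : CIn => q.2.1.levels.map ULevelRec.apexN) := ((map₀ lrec_apexN).comp (data_levels.comp cin_d) :)

/-- `amax` in unary. [folklore] -/
theorem cin_amax : CodeFP cinE unE (fun q : CIn => q.1.1.amax) :=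
  ((unAdd.comp ((unAdd.comp ((unAdd.comp (cin_D.pair cin_L)).pair cin_Wf)).pair cin_Wa)).congr fun q => by simp only [UParams.amax])

/-- The clamped scale of a task: `min (arg 0) amax`, in unary. [folklore] -/
theorem cin_sc : CodeFP cinE unE (fun q : CIn => min (q.2.2.1.args.getD 0 0) q.1.1.amax) :=
  (unOfNatMin.comp (cin_amax.pair (cin_arg 0)) :)

/-- `(1ᵃ, 1ⁿ) ↦ [1ᵃ, …, 1ᵃ]` (`n` copies). [folklore] -/
theorem replicateUn : CodeFP (pairE unE unE) (rawE unE) (fun p => List.replicate p.2 p.1) :=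
  ((map (σ := ℕ) (α := Unit) (eσ := unE) (eα := unitE) (g := fun q => q.1) (fst _ _)).comp
    ((fst _ _).pair (replicateUnit.comp (snd _ _)))).congr fun p => by simp [List.map_replicate]

/-- Unary products (as iterated sums). [folklore] -/
theorem unMul : CodeFP (pairE unE unE) unE (fun p => p.1 * p.2) :=
  ((unSum.comp replicateUn) :).congr fun p => by
    simp only [List.sum_replicate, smul_eq_mul, mul_comm]

/-- The decoded form of a certificate: `udecodeForm bB D (cert.take Wf)`. [folklore] -/
theorem cin_form : CodeFP cinE vecE (fun q : CIn => udecodeForm q.1.1.bB q.1.1.D (q.2.2.2.take q.1.1.Wf)) :=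
  (udecodeFormFP.comp (cin_bB.pair (cin_D.pair (strTake.comp (cin_Wf.pair cin_cert)))) :)

/-- The two decoded points of a certificate (`uPts`). [folklore] -/
theorem cin_pts : CodeFP cinE (pairE (pairE vecE natE) (pairE vecE natE)) (fun q : CIn => uPts q.1.1 q.2.2.2) := by
  have h1 : CodeFP cinE strE (fun q : CIn => (q.2.2.2.drop q.1.1.Wf).take q.1.1.Wa) :=
    (strTake.comp (cin_Wa.pair (strDrop.comp (cin_Wf.pair cin_cert))) :)
  have h2 : CodeFP cinE strE (fun q : CIn => (q.2.2.2.drop (q.1.1.Wf + q.1.1.Wa)).take q.1.1.Wa) :=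
    (strTake.comp (cin_Wa.pair (strDrop.comp ((unAdd.comp (cin_Wf.pair cin_Wa)).pair cin_cert))) :)
  exact (((udecodeApexFP.comp (cin_W.pair (cin_D.pair h1))).pair (udecodeApexFP.comp (cin_W.pair (cin_D.pair h2))) :)).congr
    fun q => by simp only [uPts]

/-- The meeting test at a unary exponent `e`, on the state's chart and centre. [folklore] -/
theorem cin_meets {e : CIn → ℕ} {a : CIn → List ℤ} (he : CodeFP cinE unE e) (ha : CodeFP cinE vecE a) :
    CodeFP cinE bitE (fun q : CIn => decide ((udot (a q) q.2.1.cur.m).natAbs ≤ 2 ^ e q * ufreeMass q.2.1.chart (a q))) :=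
  (uMeetsIFP'.comp (he.pair (cin_chart.pair ((scr_m.comp cin_cur).pair ha))) :)

/-- The triple core at the clamped scale, on a decoded form and two points. [cite: FournierKoiran2000, §2.1] -/
theorem cin_tripleCore {a : CIn → List ℤ} {z z' : CIn → List ℤ × ℕ} (ha : CodeFP cinE vecE a)
    (hz : CodeFP cinE (pairE vecE natE) z) (hz' : CodeFP cinE (pairE vecE natE) z') :
    CodeFP cinE bitE (fun q : CIn => uTripleCore q.1.1 q.1.2 q.2.1 (min (q.2.2.1.args.getD 0 0) q.1.1.amax) (a q) (z q) (z' q)) := by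
  have hlive : CodeFP cinE bitE (fun q : CIn => uLiveI q.1.2 (q.2.1.levels.map ULevelRec.apexN) (a q)) :=
    (uLiveIFP.comp (cin_B.pair (cin_prev.pair ha)) :)
  have he : CodeFP cinE unE (fun q : CIn => q.1.1.κ * min (q.2.2.1.args.getD 0 0) q.1.1.amax) := (unMul.comp (cin_κ.pair cin_sc) :)
  have hmeets := cin_meets he ha
  have hin : CodeFP cinE bitE (fun q : CIn => uInE q.2.1.chart q.2.1.cur.chain (z q).1 (z q).2) :=
    (uInEFP.comp (cin_chart.pair ((scr_chain.comp cin_cur).pair (hz.fst'.pair hz.snd'))) :)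
  have hin' : CodeFP cinE bitE (fun q : CIn => uInE q.2.1.chart q.2.1.cur.chain (z' q).1 (z' q).2) :=
    (uInEFP.comp (cin_chart.pair ((scr_chain.comp cin_cur).pair (hz'.fst'.pair hz'.snd'))) :)
  have hdot : CodeFP cinE bitE (fun q : CIn => decide (udot (a q) (z q).1 = 0)) :=
    (intEq.comp ((udotFP.comp (ha.pair hz.fst')).pair (const _ (0 : ℤ))) :)
  have hdot' : CodeFP cinE bitE (fun q : CIn => decide (udot (a q) (z' q).1 = 0)) :=
    (intEq.comp ((udotFP.comp (ha.pair hz'.fst')).pair (const _ (0 : ℤ))) :)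
  exact (((((hlive.and hmeets).and hin).and hdot.not).and hin').and hdot').congr fun q => by
    simp only [uTripleCore, uMeetsI]

/-- **The verifier of the existence query** at the clamped scale. [cite: FournierKoiran2000, §2.1–2.2] -/
theorem uExCheckFP : CodeFP cinE bitE (fun q : CIn => uExCheck q.1.1 q.1.2 q.2.1 (min (q.2.2.1.args.getD 0 0) q.1.1.amax) q.2.2.2) :=
  (cin_tripleCore cin_form cin_pts.fst' cin_pts.snd').congr fun q => by simp only [uExCheck]

/-- The prefix test `(cert.take w).take (|bits| + 1) = bits ++ [1]`. [folklore] -/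
theorem cin_prefix {w : CIn → ℕ} (hw : CodeFP cinE unE w) :
    CodeFP cinE bitE (fun q : CIn => decide ((q.2.2.2.take (w q)).take (q.2.1.cur.bits.length + 1) = q.2.1.cur.bits ++ [true])) := by
  have hbits : CodeFP cinE strE (fun q : CIn => q.2.1.cur.bits) := (scr_bits.comp cin_cur :)
  have hl : CodeFP cinE strE (fun q : CIn => (q.2.2.2.take (w q)).take (q.2.1.cur.bits.length + 1)) :=
    (strTake.comp ((unSucc.comp (strLength.comp hbits)).pair (strTake.comp (hw.pair cin_cert))) :)
  have hr : CodeFP cinE strE (fun q : CIn => q.2.1.cur.bits ++ [true]) := (strAppend.comp (hbits.pair (const cinE [true])) :)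
  exact ((CodeFP.eq (eα := strE) (fun _ _ h => h)).comp (hl.pair hr) :)

/-- **The verifier of the prefix query** at the clamped scale. [cite: FournierKoiran2000, §2.1 (prefix search)] -/
theorem uPfCheckFP : CodeFP cinE bitE (fun q : CIn => uPfCheck q.1.1 q.1.2 q.2.1 (min (q.2.2.1.args.getD 0 0) q.1.1.amax) q.2.2.2) := by
  have hlen : CodeFP cinE bitE (fun q : CIn => decide (q.1.1.Wf ≤ q.2.2.2.length)) := (unLeNat.comp (cin_Wf.pair (strNatLength.comp cin_cert)) :)
  exact ((hlen.and (cin_prefix cin_Wf)).and uExCheckFP).congr fun q => by simp only [uPfCheck]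

/-- **The verifier of the stability query** at the clamped scale. [cite: FournierKoiran2000, §2.1] -/
theorem uStCheckFP : CodeFP cinE bitE (fun q : CIn => uStCheck q.1.1 q.1.2 q.2.1 (min (q.2.2.1.args.getD 0 0) q.1.1.amax) q.2.2.2) := by
  have hlive : CodeFP cinE bitE (fun q : CIn => uLiveI q.1.2 (q.2.1.levels.map ULevelRec.apexN) (udecodeForm q.1.1.bB q.1.1.D (q.2.2.2.take q.1.1.Wf))) :=
    (uLiveIFP.comp (cin_B.pair (cin_prev.pair cin_form)) :)
  have he : CodeFP cinE unE (fun q : CIn => q.1.1.κ * (min (q.2.2.1.args.getD 0 0) q.1.1.amax + 1)) :=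
    (unMul.comp (cin_κ.pair (unSucc.comp cin_sc)) :)
  have hmeets := cin_meets he cin_form
  have hin : CodeFP cinE bitE (fun q : CIn => uInE q.2.1.chart q.2.1.cur.chain (uPts q.1.1 q.2.2.2).1.1 (uPts q.1.1 q.2.2.2).1.2) :=
    (uInEFP.comp (cin_chart.pair ((scr_chain.comp cin_cur).pair (cin_pts.fst'.fst'.pair cin_pts.fst'.snd'))) :)
  have hdot : CodeFP cinE bitE (fun q : CIn => decide (udot (udecodeForm q.1.1.bB q.1.1.D (q.2.2.2.take q.1.1.Wf)) (uPts q.1.1 q.2.2.2).1.1 = 0)) :=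
    (intEq.comp ((udotFP.comp (cin_form.pair cin_pts.fst'.fst')).pair (const _ (0 : ℤ))) :)
  exact ((((hlive.and hmeets).and hin).and hdot.not).congr fun q => by simp only [uStCheck, uMeetsI])

/-- **The verifier of the apex query** (stable scale clamped to `amax`). [cite: FournierKoiran2000, §2.1] -/
theorem uApCheckFP : CodeFP cinE bitE (fun q : CIn => uApCheck q.1.1 q.1.1.amax q.2.1 q.2.2.2) := by
  have hsc : CodeFP cinE unE (fun q : CIn => min ((q.2.1.cur.stable.map Prod.fst).getD 0) q.1.1.amax) :=
    (unOfNatMin.comp (cin_amax.pair (optGetD0 (scr_stSc.comp cin_cur :))) :)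
  have hch : CodeFP cinE (rawE vecE) (fun q : CIn => (q.2.1.cur.stable.map Prod.snd).getD []) := (scr_stChain.comp cin_cur :)
  have hz : CodeFP cinE (pairE vecE natE) (fun q : CIn => udecodeApex q.1.1.W q.1.1.D (q.2.2.2.take q.1.1.Wa)) :=
    (udecodeApexFP.comp (cin_W.pair (cin_D.pair (strTake.comp (cin_Wa.pair cin_cert)))) :)
  have hlen : CodeFP cinE bitE (fun q : CIn => decide (q.1.1.Wa ≤ q.2.2.2.length)) := (unLeNat.comp (cin_Wa.pair (strNatLength.comp cin_cert)) :)
  have hin : CodeFP cinE bitE (fun q : CIn => uInE q.2.1.chart ((q.2.1.cur.stable.map Prod.snd).getD [])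
      (udecodeApex q.1.1.W q.1.1.D (q.2.2.2.take q.1.1.Wa)).1 (udecodeApex q.1.1.W q.1.1.D (q.2.2.2.take q.1.1.Wa)).2) :=
    (uInEFP.comp (cin_chart.pair (hch.pair (hz.fst'.pair hz.snd'))) :)
  have hnear : CodeFP cinE bitE (fun q : CIn => uNear q.1.1.L (q.1.1.κ * (min ((q.2.1.cur.stable.map Prod.fst).getD 0) q.1.1.amax + 1))
      q.2.1.chart q.2.1.cur.m (udecodeApex q.1.1.W q.1.1.D (q.2.2.2.take q.1.1.Wa)).1 (udecodeApex q.1.1.W q.1.1.D (q.2.2.2.take q.1.1.Wa)).2) :=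
    (uNearFP.comp (cin_L.pair ((unMul.comp (cin_κ.pair (unSucc.comp hsc))).pair (cin_chart.pair ((scr_m.comp cin_cur).pair
      (hz.fst'.pair hz.snd'))))) :)
  exact (((hlen.and (cin_prefix cin_Wa)).and hin).and hnear).congr fun q => by simp only [uApCheck]

/-- **The verifier of the statement of a task** (`false` on tasks without an `NP` statement);
scales are clamped to `amax`, which is the identity on the schedule. [cite: FournierKoiran2000, §2.1] -/
def ucheck (P : UParams) (B : ℕ) (d : UData) (τ : UTask) (cert : List Bool) : Bool :=
  match τ with
  | UTask.ex sc _ => uExCheck P B d (min sc P.amax) cert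
  | UTask.pf sc _ _ => uPfCheck P B d (min sc P.amax) cert
  | UTask.st sc => uStCheck P B d (min sc P.amax) cert
  | UTask.ap _ => uApCheck P P.amax d cert
  | _ => false

/-- The tag dispatch of `ucheck`. [folklore] -/
theorem ucheck_eq (P : UParams) (B : ℕ) (d : UData) (τ : UTask) (cert : List Bool) :
    ucheck P B d τ cert =
      if τ.tag = 1 then uExCheck P B d (min (τ.args.getD 0 0) P.amax) cert
      else if τ.tag = 2 then uPfCheck P B d (min (τ.args.getD 0 0) P.amax) cert
      else if τ.tag = 3 then uStCheck P B d (min (τ.args.getD 0 0) P.amax) cert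
      else if τ.tag = 4 then uApCheck P P.amax d cert
      else false := by
  cases τ <;> simp only [ucheck, UTask.tag, UTask.args, List.getD_cons_zero, Nat.reduceEqDiff, reduceIte]

/-- **The verifier of the location procedure's `NP` statements is polynomial-time.**
[cite: FournierKoiran2000, §2.1 ("this can be checked with a boolean NP algorithm"), §2.2] -/
theorem ucheckFP : CodeFP cinE bitE (fun q : CIn => ucheck q.1.1 q.1.2 q.2.1 q.2.2.1 q.2.2.2) := by
  have htag : ∀ k : ℕ, CodeFP cinE bitE (fun q : CIn => decide (q.2.2.1.tag = k)) := fun k =>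
    (natEq.comp ((task_tag.comp cin_τ).pair (const cinE k)) :)
  exact (((htag 1).ite uExCheckFP ((htag 2).ite uPfCheckFP ((htag 3).ite uStCheckFP ((htag 4).ite uApCheckFP (const cinE false))))).congr
    fun q => by rw [ucheck_eq]; simp only [decide_eq_true_eq])

end Verifiers

end FKPointLocation

end Literature.Computability.Complexity
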